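import Literature.NumberTheory.CubicFields.MaximalCubicRings
import Literature.NumberTheory.CubicFields.SubringForms
import Literature.NumberTheory.CubicFields.ReducibleMaximality
import Literature.NumberTheory.QuadraticFields.FundamentalDiscriminant
import HarnessLib

/-!
# The maximal overring of a nondegenerate cubic ring is unique up to isomorphism

Topic `Literature/NumberTheory/CubicFields`; consolidation of `SubringForms.lean` (every
nondegenerate `R(f)` embeds in a maximal `R(g)`, `Disc f = D² Disc g`), `MaximalCubicRings.lean`
(maximal irreducible rings are the `𝓞 K`), `ReducibleMaximality.lean` (maximal reducible rings are
classified by their fundamental discriminant) and the quadratic side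
`QuadraticFields/FundamentalDiscriminant.lean` (fundamental discriminants are determined up to
rational squares).

Bhargava–Taniguchi–Thorne 2023, §2.1: "Cubic fields are in bijection with their maximal orders, and
more generally so are cubic étale algebras … The discriminant of a cubic étale algebra `F` is, by
definition, equal to the discriminant of its maximal order `𝓞_F`." For the Davenport–Heilbronn
sieve (§4.2, §5: `q`-nonmaximal rings and their overrings) one uses that every nondegenerate cubic
ring `R` sits in a well-defined maximal one. This file proves, for `R = R(f)` with `Disc f ≠ 0`:

* `RingOfForm.exists_ringHom_extend` — an embedding `R(f) ↪ L` into a field of characteristic `0`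
  extends along any finite-index `φ : R(f) ↪ R(h)` (`y ↦ ι(φ⁻¹(N y))/N`);
* `RingOfForm.isIrreducible_of_injective`, `not_isIrreducible_of_injective` — overrings of domains
  are domains, overrings of non-domains are non-domains;
* `RingOfForm.nonempty_ringEquiv_ringOfIntegers_of_overring` — **every maximal overring of an
  irreducible `R(f)` is `≅ 𝓞 K_f`** (THE maximal order of the cubic field `K_f`);
* `RingOfForm.gl2zEquiv_of_isMaximal_overrings` — **uniqueness: two maximal overrings of a
  nondegenerate `R(f)` have `GL₂(ℤ)`-equivalent forms** (isomorphic rings), in the reducible case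
  because their fundamental discriminants differ by a rational square.

## References

* M. Bhargava, T. Taniguchi, F. Thorne, *Improved error estimates for the Davenport–Heilbronn
  theorems*, Math. Ann. 389 (2024) = arXiv:2107.12819, §2.1, §4 [BhargavaTaniguchiThorne2023].
-/

namespace Literature.NumberTheory.CubicFields

namespace RingOfForm

open BinaryCubic NumberField Literature.NumberTheory.QuadraticFields

variable {f g g' h : BinaryCubic ℤ}

/-! ### Extending embeddings into fields along finite-index overrings -/

/-- **Extension of embeddings**: if `φ : R(f) ↪ R(h)` is injective (finite index `N`) and
`ι : R(f) ↪ L` is an embedding into a field of characteristic `0`, then `y ↦ ι(φ⁻¹(N y))/N` is an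
injective ring homomorphism `R(h) ↪ L` extending `ι`. [folklore] -/
theorem exists_ringHom_extend {L : Type*} [Field L] [CharZero L] (φ : RingOfForm f →+* RingOfForm h)
    (hφ : Function.Injective φ) (ι : RingOfForm f →+* L) (hι : Function.Injective ι) :
    ∃ ψ : RingOfForm h →+* L, Function.Injective ψ ∧ ψ.comp φ = ι := by
  classical
  obtain ⟨N, hN0, hN⟩ := exists_pos_forall_exists_eq_mul hφ
  have hNL : (N : L) ≠ 0 := by exact_mod_cast hN0.ne'
  let pre : RingOfForm h → RingOfForm f := fun y => (hN y).choose
  have hpre : ∀ y, φ (pre y) = (N : RingOfForm h) * y := fun y => (hN y).choose_spec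
  have huniq : ∀ y r, φ r = (N : RingOfForm h) * y → r = pre y := fun y r hr => hφ (by rw [hr, hpre])
  have hpre_mul : ∀ y y', pre y * pre y' = (N : RingOfForm f) * pre (y * y') := by
    intro y y'
    apply hφ
    rw [map_mul, hpre, hpre, map_mul, map_natCast, hpre]; ring
  have hpre_add : ∀ y y', pre y + pre y' = pre (y + y') := by
    intro y y'
    apply hφ
    rw [map_add, hpre, hpre, hpre]; ring
  have hpre_one : pre 1 = (N : RingOfForm f) := by
    symm; apply huniq; rw [map_natCast, mul_one]
  have hpre_φ : ∀ r, pre (φ r) = (N : RingOfForm f) * r := by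
    intro r; symm; apply huniq; rw [map_mul, map_natCast]
  let ψ : RingOfForm h →+* L :=
    { toFun := fun y => (N : L)⁻¹ * ι (pre y)
      map_one' := by
        simp only [hpre_one, map_natCast]
        exact inv_mul_cancel₀ hNL
      map_mul' := by
        intro y y'
        have h1 : ι (pre y) * ι (pre y') = (N : L) * ι (pre (y * y')) := by
          rw [← map_mul, hpre_mul, map_mul, map_natCast]
        field_simp
        linear_combination -h1
      map_zero' := by
        have h0 : pre 0 = 0 := by symm; apply huniq; rw [map_zero, mul_zero]
        simp only [h0, map_zero, mul_zero]
      map_add' := by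
        intro y y'
        show (N : L)⁻¹ * ι (pre (y + y')) = (N : L)⁻¹ * ι (pre y) + (N : L)⁻¹ * ι (pre y')
        rw [← hpre_add, map_add]; ring }
  have hψ : ∀ y, ψ y = (N : L)⁻¹ * ι (pre y) := fun y => rfl
  refine ⟨ψ, ?_, ?_⟩
  · intro y y' hyy'
    rw [hψ, hψ] at hyy'
    have h1 : ι (pre y) = ι (pre y') := by
      have := congrArg (fun z => (N : L) * z) hyy'
      simpa [hNL] using this
    have h2 : pre y = pre y' := hι h1
    apply natCast_mul_cancel hN0.ne'
    rw [← hpre, ← hpre, h2]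
  · ext r
    rw [RingHom.comp_apply, hψ, hpre_φ, map_mul, map_natCast, ← mul_assoc, inv_mul_cancel₀ hNL, one_mul]

/-- **Overrings of domains are domains**: if `f` is irreducible and `R(f) ↪ R(h)` then `h` is
irreducible (`R(h)` embeds in the field `K_f`). [folklore] -/
theorem isIrreducible_of_injective (hf : f.IsIrreducible) (φ : RingOfForm f →+* RingOfForm h)
    (hφ : Function.Injective φ) : h.IsIrreducible := by
  haveI : Fact f.IsIrreducible := ⟨hf⟩
  obtain ⟨ψ, hψ, -⟩ := exists_ringHom_extend φ hφ (toAdjoinRoot f) (toAdjoinRoot_injective hf.1)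
  haveI : IsDomain (RingOfForm h) := hψ.isDomain ψ
  exact isIrreducible_of_isDomain h

/-- **Overrings of non-domains are non-domains**: zero divisors survive an injective ring
homomorphism. [folklore] -/
theorem not_isIrreducible_of_injective (hf : ¬ f.IsIrreducible) (φ : RingOfForm f →+* RingOfForm h)
    (hφ : Function.Injective φ) : ¬ h.IsIrreducible := by
  intro hh
  haveI : IsDomain (RingOfForm h) := isDomain_of_isIrreducible hh
  haveI : IsDomain (RingOfForm f) := hφ.isDomain φ
  exact hf (isIrreducible_of_isDomain f)

/-! ### Irreducible case: every maximal overring is `𝓞 K_f` -/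

section Irreducible

variable [hf : Fact f.IsIrreducible]

/-- **Every maximal overring of an irreducible `R(f)` is `≅ 𝓞 K_f`**: the extension
`ψ : R(h) ↪ K_f` has integral values, so `R(h) ↪ 𝓞 K_f ≅ R(g₀)`, and maximality of `R(h)` makes this
an isomorphism (BTT 2023, §2.1: the maximal order of the cubic field). [cite: BhargavaTaniguchiThorne2023, §2.1 (the maximal order of a cubic field is the unique maximal cubic ring containing any of its orders)] -/
theorem nonempty_ringEquiv_ringOfIntegers_of_overring (φ : RingOfForm f →+* RingOfForm h)
    (hφ : Function.Injective φ) (hmax : IsMaximal h) : Nonempty (RingOfForm h ≃+* 𝓞 (RatAlgebra f)) := by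
  obtain ⟨ψ, hψ, -⟩ := exists_ringHom_extend φ hφ (toAdjoinRoot f) (toAdjoinRoot_injective hf.out.1)
  -- `R(h) → 𝓞 K_f` through the integral closure
  letI : Algebra (RingOfForm h) (RatAlgebra f) := ψ.toAlgebra
  haveI : IsScalarTower ℤ (RingOfForm h) (RatAlgebra f) := IsScalarTower.of_algebraMap_eq fun n => by simp
  let χ : RingOfForm h →+* 𝓞 (RatAlgebra f) :=
    (IsIntegralClosure.lift ℤ (𝓞 (RatAlgebra f)) (RatAlgebra f) (S := RingOfForm h)).toRingHom
  have hχ : ∀ y, algebraMap (𝓞 (RatAlgebra f)) (RatAlgebra f) (χ y) = ψ y := fun y =>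
    IsIntegralClosure.algebraMap_lift ℤ (𝓞 (RatAlgebra f)) (RatAlgebra f) y
  have hχinj : Function.Injective χ := by
    intro y y' hyy'
    apply hψ
    rw [← hχ, ← hχ, hyy']
  -- maximality of `R(h)` against `𝓞 K_f ≅ R(g₀)`
  obtain ⟨g₀, ⟨e⟩⟩ := exists_ringOfForm_ringEquiv_ringOfIntegers (K := RatAlgebra f) finrank_ratAlgebra_eq_three
  have hsurj : Function.Surjective (e.symm.toRingHom.comp χ) :=
    hmax g₀ _ (e.symm.injective.comp hχinj)
  have hχsurj : Function.Surjective χ := by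
    intro o
    obtain ⟨y, hy⟩ := hsurj (e.symm o)
    exact ⟨y, e.symm.injective hy⟩
  exact ⟨RingEquiv.ofBijective χ ⟨hχinj, hχsurj⟩⟩

/-- Hence the forms of two maximal overrings of an irreducible `R(f)` are `GL₂(ℤ)`-equivalent. [folklore] -/
theorem gl2zEquiv_of_isMaximal_overrings_of_isIrreducible (φ : RingOfForm f →+* RingOfForm g)
    (hφ : Function.Injective φ) (hg : IsMaximal g) (φ' : RingOfForm f →+* RingOfForm g')
    (hφ' : Function.Injective φ') (hg' : IsMaximal g') : GL2ZEquiv g g' := by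
  obtain ⟨e⟩ := nonempty_ringEquiv_ringOfIntegers_of_overring φ hφ hg
  obtain ⟨e'⟩ := nonempty_ringEquiv_ringOfIntegers_of_overring φ' hφ' hg'
  exact GL2ZEquiv.of_ringEquiv (e.trans e'.symm)

end Irreducible

/-! ### Reducible case: the fundamental discriminant of the maximal overring is determined -/

/-- A fundamental discriminant is not a nonzero perfect square times… : if `a² = b² E` with
`a, b ≠ 0` and `E` fundamental then `False` (so `E = (a/b)²` is impossible). [folklore] -/
theorem Int.not_isFundamental_of_sq_eq_sq_mul {a b E : ℤ} (ha : a ≠ 0) (hb : b ≠ 0) (h : a ^ 2 = b ^ 2 * E)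
    (hE : (E % 4 = 1 ∧ Squarefree E ∧ E ≠ 1) ∨ (4 ∣ E ∧ (E / 4 % 4 = 2 ∨ E / 4 % 4 = 3) ∧ Squarefree (E / 4))) :
    False := by
  -- reduce to coprime `a₁² = b₁² E`, so `b₁ = ±1` and `E = a₁²` is a square dividing `E`
  set d := Int.gcd a b with hd
  have hd0 : (d : ℤ) ≠ 0 := by
    rw [hd]; exact_mod_cast Int.gcd_ne_zero_left ha
  obtain ⟨a₁, ha₁⟩ : (d : ℤ) ∣ a := hd ▸ Int.gcd_dvd_left a b
  obtain ⟨b₁, hb₁⟩ : (d : ℤ) ∣ b := hd ▸ Int.gcd_dvd_right a b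
  have hcop : IsCoprime a₁ b₁ := by
    rw [Int.isCoprime_iff_gcd_eq_one]
    have h1 := Int.gcd_div_gcd_div_gcd (i := a) (j := b) (Int.gcd_pos_of_ne_zero_left b ha)
    rw [← hd] at h1
    have hau : a / d = a₁ := by rw [ha₁]; exact Int.mul_ediv_cancel_left a₁ hd0
    have hbu : b / d = b₁ := by rw [hb₁]; exact Int.mul_ediv_cancel_left b₁ hd0
    rwa [hau, hbu] at h1
  have hb₁0 : b₁ ≠ 0 := by
    rintro rfl
    apply hb
    rw [hb₁, mul_zero]
  have h1 : a₁ ^ 2 = b₁ ^ 2 * E := by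
    have h2 : (d : ℤ) ^ 2 * a₁ ^ 2 = (d : ℤ) ^ 2 * (b₁ ^ 2 * E) := by
      rw [ha₁, hb₁] at h; linear_combination h
    exact mul_left_cancel₀ (pow_ne_zero 2 hd0) h2
  -- `b₁² ∣ a₁²` with `(a₁, b₁) = 1` forces `b₁² = 1`
  have hdvd : b₁ ^ 2 ∣ a₁ ^ 2 := ⟨E, h1⟩
  have hunit : IsUnit (b₁ ^ 2) := (IsCoprime.pow hcop).isUnit_of_dvd' hdvd (dvd_refl _)
  have hb1 : b₁ ^ 2 = 1 := by
    rcases Int.isUnit_iff.mp hunit with h | h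
    · exact h
    · nlinarith [sq_nonneg b₁]
  rw [hb1, one_mul] at h1
  -- so `E = a₁²` is a square dividing `E`: `E ∈ {1, 4}`, neither fundamental
  rcases Quadratic.sq_eq_one_or_four_of_sq_dvd hE ⟨1, by rw [h1, mul_one]⟩ with h4 | h4
  · rw [h4] at h1
    rcases hE with ⟨-, -, hne⟩ | ⟨h4', -, -⟩
    · exact hne h1.symm
    · rw [← h1] at h4'; norm_num at h4'
  · rw [h4] at h1
    rcases hE with ⟨hm, -, -⟩ | ⟨-, hm, -⟩
    · rw [← h1] at hm; norm_num at hm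
    · rw [← h1] at hm; norm_num at hm

/-- **Fundamental-or-one discriminants differing by a rational square are equal**: if
`a² E = b² E'` with `a, b ≠ 0` and `E, E'` each a fundamental discriminant or `1`, then `E = E'`
(the quadratic side's `eq_of_isFundamental_of_eq_mul_sq`, extended by the case `1`). [folklore] -/
theorem Int.eq_of_sq_mul_eq_of_isFundamental_or_one {a b E E' : ℤ} (ha : a ≠ 0) (hb : b ≠ 0)
    (h : a ^ 2 * E = b ^ 2 * E')
    (hE : ((E % 4 = 1 ∧ Squarefree E ∧ E ≠ 1) ∨ (4 ∣ E ∧ (E / 4 % 4 = 2 ∨ E / 4 % 4 = 3) ∧ Squarefree (E / 4))) ∨ E = 1)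
    (hE' : ((E' % 4 = 1 ∧ Squarefree E' ∧ E' ≠ 1) ∨ (4 ∣ E' ∧ (E' / 4 % 4 = 2 ∨ E' / 4 % 4 = 3) ∧ Squarefree (E' / 4))) ∨ E' = 1) :
    E = E' := by
  rcases hE with hE | rfl <;> rcases hE' with hE' | rfl
  · -- both fundamental: `E = E' (b/a)²`
    have ha' : (a : ℚ) ≠ 0 := by exact_mod_cast ha
    refine Quadratic.eq_of_isFundamental_of_eq_mul_sq hE hE' (q := (b : ℚ) / a) ?_
    have h' : ((a : ℚ) ^ 2) * E = (b : ℚ) ^ 2 * E' := by exact_mod_cast h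
    field_simp
    linear_combination h'
  · -- `E` fundamental, `E' = 1`: `b² = a² E`
    rw [mul_one] at h
    exact (Int.not_isFundamental_of_sq_eq_sq_mul hb ha h.symm hE).elim
  · rw [mul_one] at h
    exact (Int.not_isFundamental_of_sq_eq_sq_mul ha hb h hE').elim
  · rfl

/-- **Uniqueness of the maximal overring, reducible case**: two maximal overrings of a reducible
nondegenerate `R(f)` have the same (fundamental-or-one) discriminant, hence equivalent forms. [folklore] -/
theorem gl2zEquiv_of_isMaximal_overrings_of_not_isIrreducible (hfr : ¬ f.IsIrreducible) (h0 : f.disc ≠ 0)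
    (φ : RingOfForm f →+* RingOfForm g) (hφ : Function.Injective φ) (hg : IsMaximal g)
    (φ' : RingOfForm f →+* RingOfForm g') (hφ' : Function.Injective φ') (hg' : IsMaximal g') :
    GL2ZEquiv g g' := by
  have hgr := not_isIrreducible_of_injective hfr φ hφ
  have hgr' := not_isIrreducible_of_injective hfr φ' hφ'
  have hdg := disc_eq_detOnQuot_sq_mul φ hφ
  have hdg' := disc_eq_detOnQuot_sq_mul φ' hφ'
  have hg0 : g.disc ≠ 0 := fun h => h0 (by rw [hdg, h, mul_zero])
  have hg0' : g'.disc ≠ 0 := fun h => h0 (by rw [hdg', h, mul_zero])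
  have hE := isFundamental_disc_of_isMaximal hg hgr hg0
  have hE' := isFundamental_disc_of_isMaximal hg' hgr' hg0'
  have heq : g.disc = g'.disc :=
    Int.eq_of_sq_mul_eq_of_isFundamental_or_one (detOnQuot_ne_zero hφ) (detOnQuot_ne_zero hφ')
      (by rw [← hdg, ← hdg']) hE hE'
  exact gl2zEquiv_of_isMaximal_of_disc_eq hg hgr hg' hgr' hg0 heq

/-- **The maximal overring of a nondegenerate cubic ring is unique up to isomorphism**
(BTT 2023, §2.1: the maximal order `𝓞_F` of the cubic étale algebra `F = R ⊗ ℚ`): any two maximal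
cubic rings containing `R(f)` (`Disc f ≠ 0`) have `GL₂(ℤ)`-equivalent forms. [cite: BhargavaTaniguchiThorne2023, §2.1 (the maximal order of a cubic étale algebra)] -/
theorem gl2zEquiv_of_isMaximal_overrings (h0 : f.disc ≠ 0)
    (φ : RingOfForm f →+* RingOfForm g) (hφ : Function.Injective φ) (hg : IsMaximal g)
    (φ' : RingOfForm f →+* RingOfForm g') (hφ' : Function.Injective φ') (hg' : IsMaximal g') :
    GL2ZEquiv g g' := by
  by_cases hf : f.IsIrreducible
  · haveI : Fact f.IsIrreducible := ⟨hf⟩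
    exact gl2zEquiv_of_isMaximal_overrings_of_isIrreducible φ hφ hg φ' hφ' hg'
  · exact gl2zEquiv_of_isMaximal_overrings_of_not_isIrreducible hf h0 φ hφ hg φ' hφ' hg'

/-- … and isomorphic rings. [folklore] -/
theorem nonempty_ringEquiv_of_isMaximal_overrings (h0 : f.disc ≠ 0)
    (φ : RingOfForm f →+* RingOfForm g) (hφ : Function.Injective φ) (hg : IsMaximal g)
    (φ' : RingOfForm f →+* RingOfForm g') (hφ' : Function.Injective φ') (hg' : IsMaximal g') :
    Nonempty (RingOfForm g ≃+* RingOfForm g') := by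
  obtain ⟨e⟩ := nonempty_ringEquiv_of_gl2zEquiv (gl2zEquiv_of_isMaximal_overrings h0 φ hφ hg φ' hφ' hg')
  exact ⟨e.symm⟩

/-- The discriminant of the maximal overring (the discriminant of the cubic étale algebra
`R(f) ⊗ ℚ`, BTT §2.1) is well defined. [folklore] -/
theorem disc_eq_of_isMaximal_overrings (h0 : f.disc ≠ 0)
    (φ : RingOfForm f →+* RingOfForm g) (hφ : Function.Injective φ) (hg : IsMaximal g)
    (φ' : RingOfForm f →+* RingOfForm g') (hφ' : Function.Injective φ') (hg' : IsMaximal g') :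
    g.disc = g'.disc :=
  ((gl2zEquiv_of_isMaximal_overrings h0 φ hφ hg φ' hφ' hg').disc_eq).symm

end RingOfForm

end Literature.NumberTheory.CubicFields
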